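import Summits.QuantumAdvantage.QuantumAdvantage.Theorems.PurityDialLawG

/-! # PurityDialLawH — part 8/13 (mechanical split for landing of `PurityDialLaw`; content verbatim; scopes re-opened with their variables) -/

set_option linter.dupNamespace false
noncomputable section

namespace Summit.QuantumAdvantage.QuantumAdvantage.Theorems.PurityDialLaw
open Classical Finset Summit.QuantumAdvantage.AdviceFreeQNC0
open Literature.Computability.MetaComplexity Literature.Computability.MetaComplexity.Smolensky
open Literature.Computability.Complexity (parityFn)

section BlockInvariant

variable {m : ℕ}

/-- the symmetric-class threshold of §17–§18 as a function of the degree: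
`symThreshold p d = 2 (p · max d 1)² (log₂ (p · max d 1) + 3)`. -/
def symThreshold (p d : ℕ) : ℕ := 2 * (p * max d 1) ^ 2 * (Nat.log 2 (p * max d 1) + 3)

/-- **the block invariant**: at every degree bound `d`, `f` is either `3`-balanced or carries a degree certificate `AND_t` with
`m + t ≤ t · symThreshold p d` (all its blocks are below the symmetric threshold). -/
def BlockInv (p : ℕ) [Fact p.Prime] : Set ((Fin m → Bool) → Bool) := fun f =>
  ∀ d : ℕ, HasDegF p f d → RelBal 3 f ∨ ∃ t : ℕ, ANDCert t f ∧ m + t ≤ t * symThreshold p d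

/-- **base: weight-determined functions satisfy the invariant** (`p` odd). -/
theorem blockInv_of_wtDetermined (p : ℕ) [hp : Fact p.Prime] (hp2 : p ≠ 2) {f : (Fin m → Bool) → Bool}
    (hsym : WtDetermined f) : BlockInv p f := by
  intro d hf
  by_cases hm : symThreshold p d ≤ m
  · left
    have hp1 : 1 < p := hp.out.one_lt
    set n := max d 1 with hn
    have hn0 : n ≠ 0 := by rw [hn]; exact Nat.ne_of_gt (lt_of_lt_of_le Nat.zero_lt_one (le_max_right d 1))
    set j := Nat.log p n + 1 with hj
    have hlt : n < p ^ j := Nat.lt_pow_succ_log_self hp1 n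
    have hle : p ^ j ≤ p * n := by
      rw [hj, pow_succ, mul_comm]
      exact Nat.mul_le_mul_left p (Nat.pow_log_le_self p hn0)
    have hd : d < p ^ j := lt_of_le_of_lt (le_max_left d 1) hlt
    refine relBal_three_of_wtDetermined p hp2 j hd (le_trans ?_ hm) hsym hf
    unfold symThreshold
    have h1 : (p ^ j) ^ 2 ≤ (p * n) ^ 2 := Nat.pow_le_pow_left hle 2
    have h2 : Nat.log 2 (p ^ j) + 3 ≤ Nat.log 2 (p * n) + 3 := Nat.add_le_add_right (Nat.log_mono_right hle) 3
    calc 2 * (p ^ j) ^ 2 * (Nat.log 2 (p ^ j) + 3) ≤ 2 * (p * n) ^ 2 * (Nat.log 2 (p * n) + 3) :=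
          Nat.mul_le_mul (Nat.mul_le_mul_left 2 h1) h2
      _ = 2 * (p * max d 1) ^ 2 * (Nat.log 2 (p * max d 1) + 3) := by rw [hn]
  · rw [not_le] at hm
    by_cases hF : ∀ z, f z = false
    · left; exact relBal_of_forall_false hF
    by_cases hT : ∀ z, f z = true
    · rcases Nat.eq_zero_or_pos m with hm0 | hmpos
      · right; exact ⟨0, andCert_zero hT, by rw [hm0]; simp⟩
      · left
        have heq := parts_eq_of_free (f := f) ⟨0, hmpos⟩ fun z => by rw [hT, hT]
        unfold RelBal; constructor <;> omega
    · right
      push Not at hF hT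
      obtain ⟨a, ha⟩ := hF
      obtain ⟨b, hb⟩ := hT
      have ha' : f a = true := by cases h : f a; exact absurd h ha; rfl
      have hb' : f b = false := by cases h : f b; rfl; exact absurd h hb
      exact ⟨1, andCert_one ha' hb', by omega⟩

/-- **step: the invariant is closed under tensor.** -/
theorem blockInv_tensor (p : ℕ) [Fact p.Prime] {k r : ℕ} {g : (Fin k → Bool) → Bool} {h : (Fin r → Bool) → Bool}
    (hG : BlockInv p g) (hH : BlockInv p h) : BlockInv p (tensor g h) := by
  intro d hf
  by_cases hh0 : ∃ u, h u = true
  · obtain ⟨u₀, hu₀⟩ := hh0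
    by_cases hg0 : ∃ y, g y = true
    · obtain ⟨y₀, hy₀⟩ := hg0
      rcases hG d (hasDegF_tensor_left p hf hu₀) with hbal | ⟨s, hs, hsk⟩
      · left; exact relBal_tensor_left g h hbal
      rcases hH d (hasDegF_tensor_right p hf hy₀) with hbal | ⟨t, ht, htr⟩
      · left; exact relBal_tensor_right g h hbal
      right
      refine ⟨s + t, andCert_tensor hs ht, ?_⟩
      rw [add_mul]; omega
    · left
      refine relBal_of_forall_false fun z => ?_
      push Not at hg0
      unfold tensor
      have : g (fun i => z (Fin.castAdd r i)) = false := by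
        cases hv : g (fun i => z (Fin.castAdd r i)); rfl; exact absurd hv (hg0 _)
      rw [this, Bool.false_and]
  · left
    refine relBal_of_forall_false fun z => ?_
    push Not at hh0
    unfold tensor
    have : h (fun j => z (Fin.natAdd k j)) = false := by
      cases hv : h (fun j => z (Fin.natAdd k j)); rfl; exact absurd hv (hh0 _)
    rw [this, Bool.and_false]

/-- **step: the invariant is closed under relabelling the coordinates** (blocks need not be consecutive). -/
theorem blockInv_permFn (p : ℕ) [Fact p.Prime] (σ : Equiv.Perm (Fin m)) {f : (Fin m → Bool) → Bool}
    (hI : BlockInv p f) : BlockInv p (permFn σ f) := by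
  intro d hf
  have hf' : HasDegF p f d := by
    have h1 := hasDegF_permFn p σ.symm hf
    have e : permFn σ.symm (permFn σ f) = f := by
      funext z; unfold permFn
      have : (fun i => (fun i' => z (σ.symm i')) (σ i)) = z := by funext i; simp
      exact congrArg f this
    rw [e] at h1; exact h1
  rcases hI d hf' with hbal | ⟨t, ht, hle⟩
  · left; exact (relBal_permFn_iff σ f 3).2 hbal
  · right; exact ⟨t, andCert_permFn σ ht, hle⟩

/-- **the invariant implies the law**: `BlockInv p f`, `deg f ≤ d`, `d · symThreshold p d < m` ⇒ `3`-balanced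
(the certificate has `t ≤ d` blocks, each below the threshold, so `m ≤ d·T − t`). -/
theorem relBal_three_of_blockInv (p : ℕ) [Fact p.Prime] {d : ℕ} {f : (Fin m → Bool) → Bool} (hI : BlockInv p f)
    (hf : HasDegF p f d) (hm : d * symThreshold p d < m) : RelBal 3 f := by
  rcases hI d hf with hbal | ⟨t, ht, hle⟩
  · exact hbal
  · exfalso
    have htd : t ≤ d := le_of_andCert p ht hf
    have : t * symThreshold p d ≤ d * symThreshold p d := Nat.mul_le_mul_right _ htd
    omega

/-- the threshold is polynomial: `d · symThreshold p d < (2p²(p+3) + 1)·(d+1)^4`. -/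
theorem mul_symThreshold_lt (p d : ℕ) (_hp : 2 ≤ p) : d * symThreshold p d < (2 * p ^ 2 * (p + 3) + 1) * (d + 1) ^ 4 := by
  unfold symThreshold
  have hmax : max d 1 ≤ d + 1 := max_le (Nat.le_succ d) (by omega)
  have hlog : Nat.log 2 (p * max d 1) + 3 ≤ (p + 3) * (d + 1) := by
    have h1 : Nat.log 2 (p * max d 1) ≤ p * max d 1 := Nat.log_le_self 2 _
    nlinarith [hmax, h1]
  have hsq : (p * max d 1) ^ 2 ≤ p ^ 2 * (d + 1) ^ 2 := by
    rw [mul_pow]; exact Nat.mul_le_mul_left _ (Nat.pow_le_pow_left hmax 2)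
  calc d * (2 * (p * max d 1) ^ 2 * (Nat.log 2 (p * max d 1) + 3))
      ≤ (d + 1) * (2 * (p ^ 2 * (d + 1) ^ 2) * ((p + 3) * (d + 1))) := by
        apply Nat.mul_le_mul (Nat.le_succ d)
        exact Nat.mul_le_mul (Nat.mul_le_mul_left 2 hsq) hlog
    _ = 2 * p ^ 2 * (p + 3) * (d + 1) ^ 4 := by ring
    _ < (2 * p ^ 2 * (p + 3) + 1) * (d + 1) ^ 4 := by
        have : 0 < (d + 1) ^ 4 := by positivity
        nlinarith

/-- **THE TENSOR CLOSURE OBEYS THE POLYNOMIAL LAW (`B = 4`, PROVED)**: for every prime `p` there is `A` (`= 2p²(p+3)+1`)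
such that every `f` with the block invariant — in particular every conjunction of weight-determined block functions over any
block structure (`blockInv_of_wtDetermined`, `blockInv_tensor`, `blockInv_permFn`) — of degree `≤ d` on `m ≥ A(d+1)^4` bits
is `3`-balanced.  No tensor power of a residue reader refutes the residual `RelSmolPolyOdd`. -/
theorem relSmolLaw_four_of_blockInv (p : ℕ) [hp : Fact p.Prime] :
    ∃ A : ℕ, ∀ m d : ℕ, A * (d + 1) ^ 4 ≤ m → ∀ f : (Fin m → Bool) → Bool, BlockInv p f → HasDegF p f d → RelBal 3 f :=
  ⟨2 * p ^ 2 * (p + 3) + 1, fun _ d hm _ hI hf =>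
    relBal_three_of_blockInv p hI hf (lt_of_lt_of_le (mul_symThreshold_lt p d hp.out.two_le) hm)⟩

end BlockInvariant

section Negation

variable {m : ℕ}

/-- input negation by a mask: `negFn s f z = f (s ⊕ z)` (flips the inputs in `{i | s i}`; weight-determined functions are NOT
closed under it — `g(|z_S| − |z_{Sᶜ}|)`-type readers enter the class here). -/
def negFn (s : Fin m → Bool) (f : (Fin m → Bool) → Bool) : (Fin m → Bool) → Bool :=
  fun z => f (fun i => xor (s i) (z i))

/-- Purity-dial helper `xorMask_xorMask` (lens-4 g6 PurityDialLaw v12 twin; see the enclosing section docstring). -/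
theorem xorMask_xorMask (s z : Fin m → Bool) : (fun i => xor (s i) (xor (s i) (z i))) = z := by
  funext i; cases s i <;> simp

/-- Purity-dial helper `negFn_negFn` (lens-4 g6 PurityDialLaw v12 twin; see the enclosing section docstring). -/
theorem negFn_negFn (s : Fin m → Bool) (f : (Fin m → Bool) → Bool) : negFn s (negFn s f) = f := by
  funext z; unfold negFn; exact congrArg f (xorMask_xorMask s z)

/-- Purity-dial helper `isLiteralMap_xorMask` (lens-4 g6 PurityDialLaw v12 twin; see the enclosing section docstring). -/
theorem isLiteralMap_xorMask (s : Fin m → Bool) : IsLiteralMap (fun z : Fin m → Bool => fun i => xor (s i) (z i)) :=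
  fun j => ⟨s j, Or.inr ⟨j, fun _ => rfl⟩⟩

/-- Purity-dial helper `hasDegF_negFn` (lens-4 g6 PurityDialLaw v12 twin; see the enclosing section docstring). -/
theorem hasDegF_negFn (p : ℕ) [Fact p.Prime] (s : Fin m → Bool) {f : (Fin m → Bool) → Bool} {d : ℕ}
    (hf : HasDegF p f d) : HasDegF p (negFn s f) d :=
  hasDegF_comp_literal hf (isLiteralMap_xorMask s)

/-- parity of a masked point: `parity (s ⊕ z) = parity s ⊕ parity z`. -/
theorem parityFn_xorMask : ∀ {m : ℕ} (s z : Fin m → Bool),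
    parityFn m (fun i => xor (s i) (z i)) = xor (parityFn m s) (parityFn m z)
  | 0, s, z => by
    have h0 : ∀ w : Fin 0 → Bool, parityFn 0 w = false := fun w => rfl
    rw [h0, h0, h0]; rfl
  | m + 1, s, z => by
    have hs : s = Fin.cons (s 0) (Fin.tail s) := by rw [Fin.cons_self_tail]
    have hz : z = Fin.cons (z 0) (Fin.tail z) := by rw [Fin.cons_self_tail]
    have hx : (fun i => xor (s i) (z i)) =
        (Fin.cons (xor (s 0) (z 0)) (fun i => xor (Fin.tail s i) (Fin.tail z i)) : Fin (m + 1) → Bool) := by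
      funext i
      refine Fin.cases ?_ (fun k => ?_) i
      · rfl
      · simp only [Fin.cons_succ]; rfl
    rw [hx, parityFn_cons, parityFn_xorMask (Fin.tail s) (Fin.tail z)]
    conv_rhs => rw [hs, hz, parityFn_cons, parityFn_cons]
    cases s 0 <;> cases z 0 <;> cases parityFn m (Fin.tail s) <;> cases parityFn m (Fin.tail z) <;> rfl

/-- Purity-dial helper `card_part_negFn` (lens-4 g6 PurityDialLaw v12 twin; see the enclosing section docstring). -/
theorem card_part_negFn (s : Fin m → Bool) (f : (Fin m → Bool) → Bool) (b : Bool) :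
    (univ.filter fun z : Fin m → Bool => negFn s f z = true ∧ parityFn m z = b).card =
      (univ.filter fun z : Fin m → Bool => f z = true ∧ parityFn m z = xor (parityFn m s) b).card := by
  refine Finset.card_bij' (fun z _ => fun i => xor (s i) (z i)) (fun z _ => fun i => xor (s i) (z i)) ?_ ?_ ?_ ?_
  · intro z hz
    rw [mem_filter] at hz ⊢
    refine ⟨mem_univ _, hz.2.1, ?_⟩
    rw [parityFn_xorMask, hz.2.2]
  · intro z hz
    rw [mem_filter] at hz ⊢
    refine ⟨mem_univ _, ?_, ?_⟩
    · show f (fun i => xor (s i) (xor (s i) (z i))) = true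
      rw [xorMask_xorMask]; exact hz.2.1
    · rw [parityFn_xorMask, hz.2.2]; cases parityFn m s <;> cases b <;> rfl
  · intro z _; exact xorMask_xorMask s z
  · intro z _; exact xorMask_xorMask s z

/-- balance is invariant under input negation (an odd mask swaps the two parts). -/
theorem relBal_negFn_iff (s : Fin m → Bool) (f : (Fin m → Bool) → Bool) (R : ℕ) :
    RelBal R (negFn s f) ↔ RelBal R f := by
  unfold RelBal oddPart evenPart
  rw [card_part_negFn s f true, card_part_negFn s f false]
  cases parityFn m s
  · exact Iff.rfl
  · exact And.comm

/-- Purity-dial helper `andCert_negFn` (lens-4 g6 PurityDialLaw v12 twin; see the enclosing section docstring). -/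
theorem andCert_negFn {t : ℕ} (s : Fin m → Bool) {f : (Fin m → Bool) → Bool} (hc : ANDCert t f) :
    ANDCert t (negFn s f) := by
  obtain ⟨E, hE, hf⟩ := hc
  refine ⟨fun y => fun i => xor (s i) (E y i), fun j => ?_, fun y => ?_⟩
  · obtain ⟨b, hb⟩ := hE j
    refine ⟨xor (s j) b, ?_⟩
    rcases hb with hc | ⟨k, hk⟩
    · exact Or.inl fun y => by dsimp only; rw [hc]
    · exact Or.inr ⟨k, fun y => by dsimp only; rw [hk, Bool.xor_assoc]⟩
  · unfold negFn
    dsimp only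
    rw [xorMask_xorMask s (E y), hf]

/-- **step: the invariant is closed under input negation.** -/
theorem blockInv_negFn (p : ℕ) [Fact p.Prime] (s : Fin m → Bool) {f : (Fin m → Bool) → Bool} (hI : BlockInv p f) :
    BlockInv p (negFn s f) := by
  intro d hf
  have hf' : HasDegF p f d := by
    have h1 := hasDegF_negFn p s hf
    rw [negFn_negFn] at h1; exact h1
  rcases hI d hf' with hbal | ⟨t, ht, hle⟩
  · left; exact (relBal_negFn_iff s f 3).2 hbal
  · right; exact ⟨t, andCert_negFn s ht, hle⟩

/-- the threshold is monotone in the degree. -/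
theorem symThreshold_mono (p : ℕ) {d d' : ℕ} (h : d ≤ d') : symThreshold p d ≤ symThreshold p d' := by
  unfold symThreshold
  have h1 : p * max d 1 ≤ p * max d' 1 := Nat.mul_le_mul_left p (max_le_max h le_rfl)
  exact Nat.mul_le_mul (Nat.mul_le_mul_left 2 (Nat.pow_le_pow_left h1 2))
    (Nat.add_le_add_right (Nat.log_mono_right h1) 3)

/-- **base: every function on a SMALL block** (`m + 1 ≤ symThreshold p 0 = 2p²(log₂ p + 3)`) satisfies the invariant —
arbitrary juntas on `< 2p²(log₂ p + 3)` coordinates may be tensored in. -/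
theorem blockInv_of_small (p : ℕ) [Fact p.Prime] {f : (Fin m → Bool) → Bool} (hm : m + 1 ≤ symThreshold p 0) :
    BlockInv p f := by
  intro d _
  by_cases hF : ∀ z, f z = false
  · left; exact relBal_of_forall_false hF
  by_cases hT : ∀ z, f z = true
  · rcases Nat.eq_zero_or_pos m with hm0 | hmpos
    · right; exact ⟨0, andCert_zero hT, by rw [hm0]; simp⟩
    · left
      have heq := parts_eq_of_free (f := f) ⟨0, hmpos⟩ fun z => by rw [hT, hT]
      unfold RelBal; constructor <;> omega
  · right
    push Not at hF hT
    obtain ⟨a, ha⟩ := hF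
    obtain ⟨b, hb⟩ := hT
    have ha' : f a = true := by cases h : f a; exact absurd h ha; rfl
    have hb' : f b = false := by cases h : f b; rfl; exact absurd h hb
    refine ⟨1, andCert_one ha' hb', ?_⟩
    have := symThreshold_mono p (Nat.zero_le d)
    omega

end Negation

section Disjunction

variable {k r : ℕ}

/-- disjunction of `g` on the leading `k` coordinates and `h` on the trailing `r` coordinates. -/
def bor (g : (Fin k → Bool) → Bool) (h : (Fin r → Bool) → Bool) : (Fin (k + r) → Bool) → Bool :=
  fun z => g (fun i => z (Fin.castAdd r i)) || h (fun j => z (Fin.natAdd k j))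

/-- Purity-dial helper `bor_append` (lens-4 g6 PurityDialLaw v12 twin; see the enclosing section docstring). -/
theorem bor_append (g : (Fin k → Bool) → Bool) (h : (Fin r → Bool) → Bool) (y : Fin k → Bool) (u : Fin r → Bool) :
    bor g h (Fin.append y u) = (g y || h u) := by
  unfold bor
  simp only [Fin.append_left, Fin.append_right]

/-- Purity-dial helper `fibrePart_bor` (lens-4 g6 PurityDialLaw v12 twin; see the enclosing section docstring). -/
theorem fibrePart_bor (g : (Fin k → Bool) → Bool) (h : (Fin r → Bool) → Bool) (u : Fin r → Bool) (b : Bool) :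
    fibrePart (bor g h) u b =
      if h u = true then (univ.filter fun y : Fin k → Bool => parityFn k y = b).card
      else (univ.filter fun y : Fin k → Bool => g y = true ∧ parityFn k y = b).card := by
  unfold fibrePart
  by_cases hu : h u = true
  · rw [if_pos hu]
    congr 1; ext y; simp only [mem_filter, mem_univ, true_and, bor_append, hu, Bool.or_true]
  · rw [if_neg hu]
    have hu' : h u = false := by cases hv : h u; rfl; exact absurd hv hu
    congr 1; ext y; simp only [mem_filter, mem_univ, true_and, bor_append, hu', Bool.or_false]

/-- parts of a disjunction (`k ≥ 1`): `part_b (g ∨ h) = #h · 2^{k-1} + A₀ · part_b g + A₁ · part_{¬b} g` with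
`A_c = #{u | h u = 0, parity u = c}`. -/
theorem card_part_bor (hk : 1 ≤ k) (g : (Fin k → Bool) → Bool) (h : (Fin r → Bool) → Bool) (b : Bool) :
    (univ.filter fun z : Fin (k + r) → Bool => bor g h z = true ∧ parityFn (k + r) z = b).card =
      (univ.filter fun u : Fin r → Bool => h u = true).card * 2 ^ (k - 1) +
      (univ.filter fun u : Fin r → Bool => h u = false ∧ parityFn r u = false).card *
          (univ.filter fun y : Fin k → Bool => g y = true ∧ parityFn k y = b).card +
      (univ.filter fun u : Fin r → Bool => h u = false ∧ parityFn r u = true).card *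
          (univ.filter fun y : Fin k → Bool => g y = true ∧ parityFn k y = !b).card := by
  have hsplit : ∀ u : Fin r → Bool, fibrePart (bor g h) u (xor b (parityFn r u)) =
      (if h u = true then 2 ^ (k - 1) else 0) +
      ((if h u = false ∧ parityFn r u = false then
          (univ.filter fun y : Fin k → Bool => g y = true ∧ parityFn k y = b).card else 0) +
      (if h u = false ∧ parityFn r u = true then
          (univ.filter fun y : Fin k → Bool => g y = true ∧ parityFn k y = !b).card else 0)) := by
    intro u
    rw [fibrePart_bor]
    rcases Bool.eq_false_or_eq_true (parityFn r u) with hpu | hpu <;>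
      rcases Bool.eq_false_or_eq_true (h u) with hu | hu <;>
      simp [hpu, hu, Summit.QuantumAdvantage.QuantumAdvantage.Theorems.PairFreezing.Pairing.card_filter_parityFn k hk]
  rw [card_part_eq_sum_fibre (bor g h) b, Finset.sum_congr rfl (fun u _ => hsplit u), Finset.sum_add_distrib,
    Finset.sum_add_distrib, ← Finset.sum_filter, Finset.sum_const, smul_eq_mul, ← Finset.sum_filter, Finset.sum_const,
    smul_eq_mul, ← Finset.sum_filter, Finset.sum_const, smul_eq_mul, add_assoc]

/-- the three classes `h = 1`, `h = 0 ∧ even`, `h = 0 ∧ odd` partition the `r`-cube. -/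
theorem card_classes_eq (h : (Fin r → Bool) → Bool) :
    (univ.filter fun u : Fin r → Bool => h u = true).card +
      ((univ.filter fun u : Fin r → Bool => h u = false ∧ parityFn r u = false).card +
       (univ.filter fun u : Fin r → Bool => h u = false ∧ parityFn r u = true).card) = 2 ^ r := by
  have h1 := Finset.card_filter_add_card_filter_not (s := (univ : Finset (Fin r → Bool))) (fun u => h u = true)
  have h2 := Finset.card_filter_add_card_filter_not (s := univ.filter fun u : Fin r → Bool => h u = false)
    (fun u => parityFn r u = false)
  rw [Finset.filter_filter, Finset.filter_filter] at h2
  have e1 : (univ.filter fun u : Fin r → Bool => ¬ h u = true) = univ.filter fun u => h u = false := by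
    congr 1; ext u; simp
  have e2 : (univ.filter fun u : Fin r → Bool => h u = false ∧ ¬ parityFn r u = false) =
      univ.filter fun u => h u = false ∧ parityFn r u = true := by
    congr 1; ext u; simp
  rw [e1] at h1
  rw [e2] at h2
  rw [h2, h1, card_univ, Fintype.card_fun, Fintype.card_bool, Fintype.card_fin]

/-- **A DISJUNCTION OVER A NON-TRIVIAL BLOCK SPLIT IS ALWAYS `3`-BALANCED** (degree-free!): for `k, r ≥ 1` and ANY `g`, `h`,
`bor g h` has `#odd ≤ 3·#even` and `#even ≤ 3·#odd` — the full fibres over `{h = 1}` are exactly balanced and outweigh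
the bias `(A₀ − A₁)(O_g − E_g)`.  So no counterexample to any member of the dial is a disjunction of block functions. -/
theorem relBal_three_bor (hk : 1 ≤ k) (hr : 1 ≤ r) (g : (Fin k → Bool) → Bool) (h : (Fin r → Bool) → Bool) :
    RelBal 3 (bor g h) := by
  unfold RelBal oddPart evenPart
  rw [card_part_bor hk g h true, card_part_bor hk g h false]
  simp only [Bool.not_true, Bool.not_false]
  set N := (univ.filter fun u : Fin r → Bool => h u = true).card with hN
  set A₀ := (univ.filter fun u : Fin r → Bool => h u = false ∧ parityFn r u = false).card with hA₀
  set A₁ := (univ.filter fun u : Fin r → Bool => h u = false ∧ parityFn r u = true).card with hA₁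
  set Og := (univ.filter fun y : Fin k → Bool => g y = true ∧ parityFn k y = true).card with hOg
  set Eg := (univ.filter fun y : Fin k → Bool => g y = true ∧ parityFn k y = false).card with hEg
  have hpart : N + (A₀ + A₁) = 2 ^ r := card_classes_eq h
  have hA₀le : A₀ ≤ 2 ^ (r - 1) := by
    rw [hA₀, ← Summit.QuantumAdvantage.QuantumAdvantage.Theorems.PairFreezing.Pairing.card_filter_parityFn r hr false]
    exact card_le_card fun u hu => by rw [mem_filter] at hu ⊢; exact ⟨hu.1, hu.2.2⟩
  have hA₁le : A₁ ≤ 2 ^ (r - 1) := by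
    rw [hA₁, ← Summit.QuantumAdvantage.QuantumAdvantage.Theorems.PairFreezing.Pairing.card_filter_parityFn r hr true]
    exact card_le_card fun u hu => by rw [mem_filter] at hu ⊢; exact ⟨hu.1, hu.2.2⟩
  have hpr : 2 ^ r = 2 * 2 ^ (r - 1) := by
    rw [← pow_succ']; congr 1; omega
  have hpk : 2 ^ k = 2 * 2 ^ (k - 1) := by
    rw [← pow_succ']; congr 1; omega
  have hng : Og + Eg ≤ 2 ^ k := by
    rw [hOg, hEg, ← card_union_of_disjoint]
    · calc _ ≤ (univ : Finset (Fin k → Bool)).card := card_le_card (subset_univ _)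
        _ = 2 ^ k := by rw [card_univ, Fintype.card_fun, Fintype.card_bool, Fintype.card_fin]
    · exact disjoint_filter.2 fun y _ h1 h2 => by rw [h1.2] at h2; exact Bool.noConfusion h2.2
  -- `A₀ ≤ N + A₁`, `A₁ ≤ N + A₀`
  have h01 : A₀ ≤ N + A₁ := by omega
  have h10 : A₁ ≤ N + A₀ := by omega
  have e1 : A₀ * Og ≤ N * Og + A₁ * Og := by nlinarith
  have e2 : A₁ * Eg ≤ N * Eg + A₀ * Eg := by nlinarith
  have e3 : A₀ * Eg ≤ N * Eg + A₁ * Eg := by nlinarith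
  have e4 : A₁ * Og ≤ N * Og + A₀ * Og := by nlinarith
  have hNk : N * (Og + Eg) ≤ N * 2 ^ (k - 1) * 2 := by
    rw [mul_assoc, ← hpk.trans (mul_comm _ _)]; exact Nat.mul_le_mul_left N hng
  constructor <;> nlinarith [hNk, e1, e2, e3, e4]

/-- hence disjunctions over a non-trivial split carry the block invariant for free. -/
theorem blockInv_bor (p : ℕ) [Fact p.Prime] (hk : 1 ≤ k) (hr : 1 ≤ r) (g : (Fin k → Bool) → Bool)
    (h : (Fin r → Bool) → Bool) : BlockInv p (bor g h) :=
  fun _ _ => Or.inl (relBal_three_bor hk hr g h)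

end Disjunction


end Summit.QuantumAdvantage.QuantumAdvantage.Theorems.PurityDialLaw
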